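import Summits.ResolutionOfSingularities.ResolutionOfSingularities.Theorems.HomologicalConductorNoZenoRRelativelyMinimal
import Literature.AlgebraicGeometry.Resolution.BlowupsLocal
import HarnessLib

/-!
# Crux `NoZenoR` (stmt-ResolutionOfSingularities-19943) — a morphism of desingularizations contracting exactly ONE
# integral exceptional curve to a point IS the blowing up of that point (the `IsBlowup` clause of Lipman (27.1))

Route `ResolutionOfSingularities/HomologicalConductor` (cell decomp-res, hand leafhand-res-homologicalconduct-18 g1).
OURS: AI-written proof over tree theorems, weaker than expert review; nothing here is a statement of the manuscript
under review (Hironaka 2017).  SUPPORT level, counted 0.  Def-free, no new named facts.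

The named fact `Lipman1969_27_1_reg_rat` (rational contraction of first-kind curves) ends with the clause «`h` is the
blowing-up of `Y` along the reduced finite set of the contracted points» (`IsBlowup h (vanishingIdeal (h '' F))`),
justified in print by Theorem (4.1) (factorisation into quadratic transformations).  For ONE contracted curve this
clause FOLLOWS from the others — a future proof of (27.1) need not construct it:

* `ncard_excCurvePoints_le_succ_of_contracts_one` — if `h : X → Y` (an `S`-morphism of desingularizations of the
  two-dimensional Noetherian local normal domain `S`) is an isomorphism off the closed point `y = h η` and
  `h⁻¹(y) = cl{η}` for an integral exceptional curve `E_η`, then `#excCurvePoints π ≤ #excCurvePoints ρ + 1`;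
* **`isBlowup_of_contracts_one`** — and `h` IS a blowing up of `Y` at `y`: `h` is not an isomorphism, so it factors
  through a blowing up `b : Y₁ → Y` of a closed point `y'` contracting a curve `η'` (`FirstKind.exists_fac_blowup_point_of_not_isIso`);
  `y' = y` because off `y` the morphism `h` is injective and closed points pull back to closed points; the factor
  `h₁ : X → Y₁` is an `S`-morphism of desingularizations which cannot lose a curve (`#excCurvePoints (b ≫ ρ) = #ρ + 1
  ≥ #π`), hence is an isomorphism (`ncard_excCurvePoints_succ_le_of_not_isIso`), and blow-ups transport along
  isomorphisms of the source (`IsBlowup.iso_comp`).  No first-kind hypothesis is needed (it follows a posteriori).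

No crux or summit statement is proved here.
-/

noncomputable section

-- single-problem summit: the doubled namespace component `ResolutionOfSingularities` is forced
set_option linter.dupNamespace false

open CategoryTheory AlgebraicGeometry TopologicalSpace Topology IsLocalRing
open Literature.AlgebraicGeometry.Resolution
open Scheme.IdealSheafData
open Summit.ResolutionOfSingularities.ResolutionOfSingularities.Theorems.NoZeno.ExcCount.FirstKind

namespace Summit.ResolutionOfSingularities.ResolutionOfSingularities.Theorems.NoZeno.FirstKind

variable {S : Type} [CommRing S] [IsNoetherianRing S] [IsLocalRing S] [IsDomain S] [IsIntegrallyClosed S]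
  {X Y : Scheme.{0}} {ρ : Y ⟶ Spec (.of S)} {h : X ⟶ Y}

omit [IsNoetherianRing S] [IsDomain S] [IsIntegrallyClosed S] in
/-- Off the contracted point an isomorphism-off-`y` morphism is injective. [folklore] -/
theorem eq_of_base_eq_of_isIso_morphismRestrict {y : Y} (hy : IsClosed ({y} : Set Y))
    [IsIso (h ∣_ (⟨{y}ᶜ, hy.isOpen_compl⟩ : Y.Opens))] {x₁ x₂ : X} (h₁ : h.base x₁ ≠ y)
    (h₁₂ : h.base x₁ = h.base x₂) : x₁ = x₂ := by
  set U : Y.Opens := ⟨{y}ᶜ, hy.isOpen_compl⟩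
  have hx₁ : x₁ ∈ h ⁻¹ᵁ U := h₁
  have hx₂ : x₂ ∈ h ⁻¹ᵁ U := by
    change h.base x₂ ∈ ({y}ᶜ : Set Y)
    rw [← h₁₂]; exact h₁
  have hinj : Function.Injective (h ∣_ U).base := (h ∣_ U).homeomorph.injective
  have key : (h ∣_ U).base ⟨x₁, hx₁⟩ = (h ∣_ U).base ⟨x₂, hx₂⟩ := by
    apply Subtype.ext
    rw [morphismRestrict_base_coe, morphismRestrict_base_coe]
    exact h₁₂
  exact congrArg Subtype.val (hinj key)

omit [IsNoetherianRing S] [IsDomain S] [IsIntegrallyClosed S] in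
/-- Off the contracted point, non-closed points map to non-closed points under an isomorphism-off-`y` morphism
(the fibre of a closed image point is the closed singleton `{x}`). [folklore] -/
theorem not_isClosed_image_of_isIso_morphismRestrict {y : Y} (hy : IsClosed ({y} : Set Y))
    [IsIso (h ∣_ (⟨{y}ᶜ, hy.isOpen_compl⟩ : Y.Opens))] {x : X} (hx : h.base x ≠ y)
    (hxcl : ¬ IsClosed ({x} : Set X)) : ¬ IsClosed ({h.base x} : Set Y) := by
  intro hcl
  apply hxcl
  have hfib : ({x} : Set X) = h.base ⁻¹' {h.base x} := by
    ext z
    simp only [Set.mem_singleton_iff, Set.mem_preimage]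
    refine ⟨fun hz => by rw [hz], fun hz => ?_⟩
    exact eq_of_base_eq_of_isIso_morphismRestrict hy (by rw [hz]; exact hx) hz
  rw [hfib]
  exact hcl.preimage h.continuous

omit [IsIntegrallyClosed S] in
/-- **A morphism contracting exactly one exceptional curve loses at most one curve**: for `S` a two-dimensional
Noetherian local domain, `ρ : Y → Spec S` and `h ≫ ρ` desingularizations, `η ∈ excCurvePoints (h ≫ ρ)` with `h η`
closed, `h⁻¹(h η) = cl{η}` and `h` an isomorphism off `h η`: `#excCurvePoints (h ≫ ρ) ≤ #excCurvePoints ρ + 1` (the other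
exceptional curves of `X` map injectively to exceptional curves of `Y`). [cite: Lipman1969, Theorem (27.1) (p. 275)] -/
theorem ncard_excCurvePoints_le_succ_of_contracts_one (h2 : ringKrullDim S = 2) (hπ : IsResolution (h ≫ ρ))
    (hρ : IsResolution ρ) {η : X} (hη : η ∈ excCurvePoints (h ≫ ρ)) (hy : IsClosed ({h.base η} : Set Y))
    (hfib : h.base ⁻¹' {h.base η} = closure {η})
    [IsIso (h ∣_ (⟨{h.base η}ᶜ, hy.isOpen_compl⟩ : Y.Opens))] :
    (excCurvePoints (h ≫ ρ)).ncard ≤ (excCurvePoints ρ).ncard + 1 := by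
  classical
  have hfinY := hρ.excCurvePoints_finite h2
  have hfinX := hπ.excCurvePoints_finite h2
  -- the other exceptional curves do not meet the fibre over `h η`
  have hoff : ∀ x ∈ excCurvePoints (h ≫ ρ) \ {η}, h.base x ≠ h.base η := by
    rintro x ⟨hx, hxη⟩ hxy
    have hxncl : ¬ IsClosed ({x} : Set X) := ((hπ.mem_excCurvePoints_iff h2).1 hx).2
    have hxmem : x ∈ closure ({η} : Set X) := by
      have : x ∈ h.base ⁻¹' {h.base η} := hxy
      rwa [hfib] at this
    -- `x` is a proper specialisation of `η`, hence of height `0`, hence closed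
    have hsp : η ⤳ x := specializes_iff_mem_closure.mpr hxmem
    have hlt : x < η := lt_iff_le_not_ge.mpr ⟨Scheme.le_iff_specializes.mpr hsp, fun hge =>
      hxη ((Scheme.le_iff_specializes.mp hge).antisymm hsp).eq⟩
    have h1 := Order.height_add_one_le hlt
    rw [hη.2, hx.2] at h1
    exact absurd h1 (by decide)
  have hmaps : Set.MapsTo h.base (excCurvePoints (h ≫ ρ) \ {η}) (excCurvePoints ρ) := by
    intro x hx
    have hxy := hoff x hx
    have hxncl : ¬ IsClosed ({x} : Set X) := ((hπ.mem_excCurvePoints_iff h2).1 hx.1).2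
    have hover : ρ.base (h.base x) = closedPoint S := by
      rw [← Scheme.Hom.comp_apply]; exact hx.1.1
    refine ⟨hover, le_antisymm (hρ.height_le_one_of_base_eq_closedPoint h2 hover) ?_⟩
    refine Order.one_le_iff_ne_zero.mpr fun h0 => ?_
    exact not_isClosed_image_of_isIso_morphismRestrict hy hxy hxncl (isClosed_singleton_of_height_eq_zero' h0)
  have hinjOn : Set.InjOn h.base (excCurvePoints (h ≫ ρ) \ {η}) := fun x₁ hx₁ x₂ _ heq =>
    eq_of_base_eq_of_isIso_morphismRestrict hy (hoff x₁ hx₁) heq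
  have hle : (excCurvePoints (h ≫ ρ) \ {η}).ncard ≤ (excCurvePoints ρ).ncard :=
    Set.ncard_le_ncard_of_injOn h.base hmaps hinjOn hfinY
  have hdiff : (excCurvePoints (h ≫ ρ) \ {η}).ncard + 1 = (excCurvePoints (h ≫ ρ)).ncard :=
    Set.ncard_sdiff_singleton_add_one hη hfinX
  omega

/-- **A morphism of desingularizations contracting exactly one integral exceptional curve is the blowing up of the
contracted point.**  `S` a two-dimensional Noetherian local normal domain, `ρ : Y → Spec S` and `h ≫ ρ : X → Spec S`
desingularizations, `η ∈ excCurvePoints (h ≫ ρ)` with `y = h η` closed, `h⁻¹(y) = cl{η}` and `h` an isomorphism of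
`X ∖ cl{η}` onto `Y ∖ {y}`.  Then `IsBlowup h (vanishingIdeal {y})` — the last clause of `Lipman1969_27_1_reg_rat` at one
curve, from its other clauses (no first-kind hypothesis needed).
[cite: Lipman1969, Theorem (27.1) (p. 275) with Theorem (4.1) (p. 204)]; [cite: StacksProject, Tag 0C5R] -/
theorem isBlowup_of_contracts_one (h2 : ringKrullDim S = 2) (hπ : IsResolution (h ≫ ρ)) (hρ : IsResolution ρ)
    {η : X} (hη : η ∈ excCurvePoints (h ≫ ρ)) (hy : IsClosed ({h.base η} : Set Y))
    (hfib : h.base ⁻¹' {h.base η} = closure {η})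
    [IsIso (h ∣_ (⟨{h.base η}ᶜ, hy.isOpen_compl⟩ : Y.Opens))] :
    IsBlowup h (vanishingIdeal ⟨{h.base η}, hy⟩) := by
  have hηncl : ¬ IsClosed ({η} : Set X) := ((hπ.mem_excCurvePoints_iff h2).1 hη).2
  -- Step 1: `h` is not an isomorphism (it contracts the curve `cl{η}`)
  have hne : ¬ IsIso h := by
    intro hI
    apply hηncl
    have hinj : Function.Injective h.base := (Scheme.homeoOfIso (asIso h)).injective
    refine closure_subset_iff_isClosed.mp fun z hz => ?_
    have hz' : z ∈ h.base ⁻¹' {h.base η} := by rw [hfib]; exact hz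
    exact hinj hz'
  -- Step 2: the non-isomorphism locus is the point `h η`
  obtain ⟨y', hy', -, hy'2, ⟨η', hη', hη'y'⟩, hfac⟩ := exists_fac_blowup_point_of_not_isIso h2 hπ hρ hne
  have hyy' : y' = h.base η := by
    by_contra hne'
    have hη'ncl : ¬ IsClosed ({η'} : Set X) := ((hπ.mem_excCurvePoints_iff h2).1 hη').2
    have hoff : h.base η' ≠ h.base η := by rw [hη'y']; exact hne'
    exact not_isClosed_image_of_isIso_morphismRestrict hy hoff hη'ncl (by rw [hη'y']; exact hy')
  subst hyy'
  -- Step 3: blow up `h η` and factor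
  obtain ⟨Y₁, b, hb⟩ := exists_isBlowup Y (vanishingIdeal ⟨{h.base η}, hy⟩)
  obtain ⟨h₁, hh₁⟩ := hfac hb
  have hbρ : IsResolution (b ≫ ρ) := isResolution_blowup_point_comp hρ hy hy'2 hb
  -- Step 4: the factor `h₁` cannot lose a curve, hence is an isomorphism
  have hc2 := ncard_excCurvePoints_blowup_point h2 ρ hρ hy hy'2 b hb hbρ
  have hcX := ncard_excCurvePoints_le_succ_of_contracts_one h2 hπ hρ hη hy hfib
  have hiso₁ : IsIso h₁ := by
    by_contra hne₁
    have hfac₁ : h₁ ≫ b ≫ ρ = h ≫ ρ := by rw [← Category.assoc, hh₁]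
    have := ncard_excCurvePoints_succ_le_of_not_isIso h2 hπ hbρ hfac₁ hne₁
    omega
  -- Step 5: transport the blow-up along the isomorphism `h₁`
  have key : IsBlowup ((asIso h₁).hom ≫ b) (vanishingIdeal ⟨{h.base η}, hy⟩) := hb.iso_comp (asIso h₁)
  rwa [asIso_hom, hh₁] at key

end Summit.ResolutionOfSingularities.ResolutionOfSingularities.Theorems.NoZeno.FirstKind

end
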